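import Literature.Analysis.Complex.LoewnerMatrixCalculus
import HarnessLib

/-!
# Functions of Hermitian matrices are Hilbert–Schmidt Lipschitz with the scalar Lipschitz constant

For Hermitian `X, Y ∈ M_ι(ℂ)` and a real function `f` whose slope function `L` (`L a b (a − b) = f a − f b`) is
bounded by `K` on `spec X × spec Y` — in particular for every `K`-Lipschitz `f` — the functional calculus satisfies
the SHARP Frobenius (Hilbert–Schmidt) bound

  `∑_{i,j} ‖(f(X) − f(Y))_{ij}‖² ≤ K² · ∑_{i,j} ‖(X − Y)_{ij}‖²`,

with no dimension factor (contrast the crude `ℓ¹` bound `entrySum_cfc_sub_cfc_le`, factor `|ι|⁴`). Proof: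
Rosenblum–Rovnyak's Lemma A (`Literature.Analysis.Complex.lemmaA`: in mixed eigenbases `U⋆(f(X) − f(Y))V` is the
Hadamard product of the slope matrix `(L(xᵢ, y_k))` with `U⋆(X − Y)V`) and the unitary invariance of the
Hilbert–Schmidt norm. This is the finite-dimensional case of Kittaneh's inequality for Lipschitz functions of normal
operators; it is the tool that makes one-body density matrices `f_β(H(k))` of quasi-free states Lipschitz in the
Bloch momentum `k` with constant `Lip(f_β)·Lip(H)` (Riemann-sum control of momentum sums, uniformly in the dimension
of the Bloch block).

* `sum_norm_sq_eq_re_trace` — `∑ ‖A i j‖² = Re Tr(Aᴴ A)`;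
* `sum_norm_sq_unitary_mul` / `sum_norm_sq_mul_unitary` — invariance under `A ↦ U A`, `A ↦ A V` (`U⋆U = 1`, `VV⋆ = 1`);
* `sum_norm_sq_hadamard_le` — `∑ ‖(L ⊙ B) i j‖² ≤ K² ∑ ‖B i j‖²` when `‖L i j‖ ≤ K`;
* `sum_norm_sq_cfc_sub_cfc_le` — the slope-function form; `sum_norm_sq_cfc_sub_cfc_le_of_lipschitz` — the
  `LipschitzWith` form; `norm_cfc_sub_cfc_apply_le_of_lipschitz` — one entry against the Frobenius distance.

References: Rosenblum–Rovnyak, *Hardy Classes and Operator Theory* (1985), Ch. 2 Examples and Addenda no. 3, Lemma A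
[RosenblumRovnyak1985]; Horn–Johnson, *Matrix Analysis* (2nd ed., 2012) §5.6 eq. (5.6.0.2) and Problem 5.6.P20
[HornJohnson2012]; F. Kittaneh, *On Lipschitz functions of normal operators*, Proc. Amer. Math. Soc. 94 (1985)
416–418 (the statement for normal operators; here: Hermitian matrices, folklore corollary of Lemma A).
-/

noncomputable section

open Finset Matrix
open scoped ComplexConjugate

namespace Literature.LinearAlgebra.Matrix

section HilbertSchmidt

variable {ι : Type*} [Fintype ι] [DecidableEq ι]

omit [DecidableEq ι] in
/-- `∑_{i,j} ‖A_{ij}‖² = Re Tr(Aᴴ A)` — the Frobenius (Hilbert–Schmidt) norm squared as a trace.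
[cite: HornJohnson2012, §5.6 eq. (5.6.0.2)] -/
theorem sum_norm_sq_eq_re_trace (A : Matrix ι ι ℂ) :
    ∑ i, ∑ j, ‖A i j‖ ^ 2 = (Matrix.trace (Aᴴ * A)).re := by
  rw [Matrix.trace, Complex.re_sum, Finset.sum_comm]
  refine Finset.sum_congr rfl fun j _ => ?_
  rw [Matrix.diag_apply, Matrix.mul_apply, Complex.re_sum]
  refine Finset.sum_congr rfl fun i _ => ?_
  rw [Matrix.conjTranspose_apply, Complex.star_def, Complex.conj_mul', ← Complex.ofReal_pow, Complex.ofReal_re]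

/-- Left unitary invariance of the Frobenius norm: `∑ ‖(U A)_{ij}‖² = ∑ ‖A_{ij}‖²` when `U⋆ U = 1`.
[cite: HornJohnson2012, §5.6, unitary invariance of the Frobenius norm after eq. (5.6.0.2); Problem 5.6.P20] -/
theorem sum_norm_sq_unitary_mul {U : Matrix ι ι ℂ} (hU : star U * U = 1) (A : Matrix ι ι ℂ) :
    ∑ i, ∑ j, ‖(U * A) i j‖ ^ 2 = ∑ i, ∑ j, ‖A i j‖ ^ 2 := by
  rw [sum_norm_sq_eq_re_trace, sum_norm_sq_eq_re_trace, Matrix.conjTranspose_mul,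
    show Aᴴ * Uᴴ * (U * A) = Aᴴ * (star U * U) * A by rw [Matrix.star_eq_conjTranspose]; simp only [Matrix.mul_assoc],
    hU, Matrix.mul_one]

/-- Right unitary invariance of the Frobenius norm: `∑ ‖(A V)_{ij}‖² = ∑ ‖A_{ij}‖²` when `V V⋆ = 1`.
[cite: HornJohnson2012, §5.6, unitary invariance of the Frobenius norm after eq. (5.6.0.2); Problem 5.6.P20] -/
theorem sum_norm_sq_mul_unitary {V : Matrix ι ι ℂ} (hV : V * star V = 1) (A : Matrix ι ι ℂ) :
    ∑ i, ∑ j, ‖(A * V) i j‖ ^ 2 = ∑ i, ∑ j, ‖A i j‖ ^ 2 := by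
  rw [sum_norm_sq_eq_re_trace, sum_norm_sq_eq_re_trace, Matrix.conjTranspose_mul,
    show Vᴴ * Aᴴ * (A * V) = Vᴴ * (Aᴴ * A) * V by simp only [Matrix.mul_assoc], Matrix.trace_mul_cycle,
    show V * Vᴴ = V * star V by rw [Matrix.star_eq_conjTranspose], hV, Matrix.one_mul]

omit [DecidableEq ι] in
/-- Hadamard products with entries bounded by `K` contract the Hilbert–Schmidt norm by `K`:
`∑ ‖(L ⊙ B)_{ij}‖² ≤ K² ∑ ‖B_{ij}‖²` (the entrywise estimate of Horn–Johnson's Problem 5.6.P20, `Σ ↦ L`).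
[cite: HornJohnson2012, §5.6 Problem 5.6.P20] -/
theorem sum_norm_sq_hadamard_le {L B : Matrix ι ι ℂ} {K : ℝ} (hL : ∀ i j, ‖L i j‖ ≤ K) :
    ∑ i, ∑ j, ‖(L ⊙ B) i j‖ ^ 2 ≤ K ^ 2 * ∑ i, ∑ j, ‖B i j‖ ^ 2 := by
  rw [Finset.mul_sum]
  refine Finset.sum_le_sum fun i _ => ?_
  rw [Finset.mul_sum]
  refine Finset.sum_le_sum fun j _ => ?_
  rw [Matrix.hadamard_apply, norm_mul, mul_pow]
  exact mul_le_mul_of_nonneg_right (pow_le_pow_left₀ (norm_nonneg _) (hL i j) 2) (sq_nonneg _)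

/-- **Hilbert–Schmidt Lipschitz bound for functions of Hermitian matrices** (slope-function form). If `X, Y` are
Hermitian and `L` is a slope function of `f` (`L a b (a − b) = f a − f b`) with `|L(xᵢ, y_k)| ≤ K` on the two
spectra, then `∑ ‖(f(X) − f(Y))_{ij}‖² ≤ K² ∑ ‖(X − Y)_{ij}‖²` — no dimension factor.
[cite: RosenblumRovnyak1985, Ch. 2 Examples and Addenda no. 3 Lemma A] -/
theorem sum_norm_sq_cfc_sub_cfc_le {X Y : Matrix ι ι ℂ} (hX : X.IsHermitian) (hY : Y.IsHermitian)
    (f : ℝ → ℝ) {L : ℝ → ℝ → ℝ} (hL : ∀ a b, L a b * (a - b) = f a - f b) {K : ℝ}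
    (hK : ∀ i k, |L (hX.eigenvalues i) (hY.eigenvalues k)| ≤ K) :
    ∑ i, ∑ j, ‖(cfc f X - cfc f Y) i j‖ ^ 2 ≤ K ^ 2 * ∑ i, ∑ j, ‖(X - Y) i j‖ ^ 2 := by
  set UX : Matrix ι ι ℂ := (hX.eigenvectorUnitary : Matrix ι ι ℂ) with hUX
  set UY : Matrix ι ι ℂ := (hY.eigenvectorUnitary : Matrix ι ι ℂ) with hUY
  have hA := Literature.Analysis.Complex.lemmaA hX hY f hL
  have hXu : UX * star UX = 1 := Unitary.coe_mul_star_self hX.eigenvectorUnitary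
  have hXu' : star UX * UX = 1 := Unitary.coe_star_mul_self hX.eigenvectorUnitary
  have hYu : UY * star UY = 1 := Unitary.coe_mul_star_self hY.eigenvectorUnitary
  have hYu' : star UY * UY = 1 := Unitary.coe_star_mul_self hY.eigenvectorUnitary
  -- conjugate into the mixed eigenbases (Hilbert–Schmidt invariant), apply Lemma A, contract, conjugate back
  have step1 : ∑ i, ∑ j, ‖(cfc f X - cfc f Y) i j‖ ^ 2 = ∑ i, ∑ j, ‖(star UX * (cfc f X - cfc f Y) * UY) i j‖ ^ 2 := by
    rw [sum_norm_sq_mul_unitary hYu, sum_norm_sq_unitary_mul (by rw [star_star]; exact hXu)]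
  have step3 : ∑ i, ∑ j, ‖(star UX * (X - Y) * UY) i j‖ ^ 2 = ∑ i, ∑ j, ‖(X - Y) i j‖ ^ 2 := by
    rw [sum_norm_sq_mul_unitary hYu, sum_norm_sq_unitary_mul (by rw [star_star]; exact hXu)]
  rw [step1, hA, ← step3]
  refine sum_norm_sq_hadamard_le fun i k => ?_
  rw [Matrix.of_apply, Complex.norm_real, Real.norm_eq_abs]
  exact hK i k

/-- **Hilbert–Schmidt Lipschitz bound for functions of Hermitian matrices** (`LipschitzWith` form): for Hermitian
`X, Y` and a `K`-Lipschitz `f : ℝ → ℝ`, `∑ ‖(f(X) − f(Y))_{ij}‖² ≤ K² ∑ ‖(X − Y)_{ij}‖²` (Kittaneh's inequality,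
matrix case). [cite: RosenblumRovnyak1985, Ch. 2 Examples and Addenda no. 3 Lemma A] -/
theorem sum_norm_sq_cfc_sub_cfc_le_of_lipschitz {X Y : Matrix ι ι ℂ} (hX : X.IsHermitian) (hY : Y.IsHermitian)
    {f : ℝ → ℝ} {K : NNReal} (hf : LipschitzWith K f) :
    ∑ i, ∑ j, ‖(cfc f X - cfc f Y) i j‖ ^ 2 ≤ (K : ℝ) ^ 2 * ∑ i, ∑ j, ‖(X - Y) i j‖ ^ 2 := by
  -- the difference-quotient slope function, `0` on the diagonal
  classical
  refine sum_norm_sq_cfc_sub_cfc_le hX hY f (L := fun a b => if a = b then 0 else (f a - f b) / (a - b))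
    (fun a b => ?_) fun i k => ?_
  · by_cases hab : a = b
    · simp [hab]
    · rw [if_neg hab, div_mul_cancel₀ _ (sub_ne_zero.2 hab)]
  · by_cases hab : hX.eigenvalues i = hY.eigenvalues k
    · simp [hab]
    · rw [if_neg hab, abs_div, div_le_iff₀ (abs_pos.2 (sub_ne_zero.2 hab))]
      have := hf.dist_le_mul (hX.eigenvalues i) (hY.eigenvalues k)
      simpa only [Real.dist_eq] using this

/-- One entry against the Frobenius distance: for Hermitian `X, Y`, `K`-Lipschitz `f` and any entry `(a, b)`,
`‖(f(X) − f(Y))_{ab}‖ ≤ K · √(∑ ‖(X − Y)_{ij}‖²)`. [cite: RosenblumRovnyak1985, Ch. 2 Examples and Addenda no. 3 Lemma A] -/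
theorem norm_cfc_sub_cfc_apply_le_of_lipschitz {X Y : Matrix ι ι ℂ} (hX : X.IsHermitian) (hY : Y.IsHermitian)
    {f : ℝ → ℝ} {K : NNReal} (hf : LipschitzWith K f) (a b : ι) :
    ‖(cfc f X - cfc f Y) a b‖ ≤ (K : ℝ) * Real.sqrt (∑ i, ∑ j, ‖(X - Y) i j‖ ^ 2) := by
  have h := sum_norm_sq_cfc_sub_cfc_le_of_lipschitz hX hY hf
  have hab : ‖(cfc f X - cfc f Y) a b‖ ^ 2 ≤ ∑ i, ∑ j, ‖(cfc f X - cfc f Y) i j‖ ^ 2 := by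
    have h1 : ‖(cfc f X - cfc f Y) a b‖ ^ 2 ≤ ∑ j, ‖(cfc f X - cfc f Y) a j‖ ^ 2 :=
      Finset.single_le_sum (f := fun j => ‖(cfc f X - cfc f Y) a j‖ ^ 2) (fun j _ => sq_nonneg _) (Finset.mem_univ b)
    exact h1.trans (Finset.single_le_sum (f := fun i => ∑ j, ‖(cfc f X - cfc f Y) i j‖ ^ 2)
      (fun i _ => Finset.sum_nonneg fun j _ => sq_nonneg _) (Finset.mem_univ a))
  calc ‖(cfc f X - cfc f Y) a b‖ = Real.sqrt (‖(cfc f X - cfc f Y) a b‖ ^ 2) := by rw [Real.sqrt_sq (norm_nonneg _)]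
    _ ≤ Real.sqrt ((K : ℝ) ^ 2 * ∑ i, ∑ j, ‖(X - Y) i j‖ ^ 2) := Real.sqrt_le_sqrt (hab.trans h)
    _ = (K : ℝ) * Real.sqrt (∑ i, ∑ j, ‖(X - Y) i j‖ ^ 2) := by
        rw [Real.sqrt_mul (sq_nonneg _), Real.sqrt_sq K.coe_nonneg]

end HilbertSchmidt

end Literature.LinearAlgebra.Matrix
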